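import Summits.HubbardSuperconductivity.HubbardSuperconductivity.Theses.LiebTwin
import Summits.HubbardSuperconductivity.HubbardSuperconductivity.Theorems.LiebTwinNoOnsiteODLROFreeEndpointToolbox
import Literature.MathematicalPhysics.QuantumLattice.FreeFermionSectorDeviationExact

/-!
# Crux `NoOnsiteODLRO` (stmt-HubbardSuperconductivity-0933; routes `LiebTwin`, `EnslavedA1g`) —
# the FREE ENDPOINT `U = 0`: every sector ground state of the free torus has on-site pair
# structure factor `O(L²)`, open shells included

The crux asks, for `0 < U`, that every admissible `(N_L, S^z = 0)`-sector ground-state sequence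
of `hubbardTorus 2 L 1 U` has `S_L := Re⟨ψ_L, P_sᴴ P_s ψ_L⟩ = o(L⁴)`, `P_s = pairField sWave L`.
This file settles the boundary case `U = 0` of the parameter range (recorded as "true on paper,
not done" in `Cruxes/NoOnsiteODLRO/Disproof.lean` §3): for the FREE torus (`L ≥ 3`) and EVERY
ground state `ψ` of EVERY sector `(N, S^z = 0)` — the exponentially degenerate open shells
included —

  `Re⟨ψ, P_sᴴ P_s ψ⟩ ≤ N + 8 L²`                    (`re_expect_pairField_sWave_le_free`),

hence the crux's conclusion holds verbatim at `U = 0` for every `δ` and every admissible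
sequence (`noOnsiteODLRO_freeEndpoint`). So the hypothesis `0 < U` of the crux is load-bearing
only against `U < 0` (where the statement is the open attractive `s`-wave BEC), not at the
endpoint.

Proof (momentum space, no Wick theorem, no Slater basis). `P_s = -√2 Σ_k b_k`,
`b_k = c_{-k↓}c_{k↑}` (`Negative.pairField_sWave_eq_neg_smul_sum_pairMode`, whose file
`Negative/FreeEndpointTightness.lean` records the matching FLOOR `S_L = N_L` on paired Fermi seas —
so the ceiling below is sharp up to the shell term). A sector ground state of
`H₀ = Σ_{kσ} ε_L(k) n_{kσ}` has zero bathtub excess, so by the exact deviation identity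
(`exists_fermiSet_deviation_le_energy_excess`) its `↑`-occupations are `x_k = 1` strictly below a
Fermi level `ε_F` and `x_k = 0` strictly above it; only the shell `{ε_L = ε_F}` is free.
Above the shell `c_{k↑}ψ = 0`, so `b_k ψ = 0`; below it `n_{k↑}ψ = ψ`, so `b_k ψ ⊥ b_{k'} ψ` for
every `k' ≠ k` (`n_{k↑} b_k = 0`, `n_{k↑}` commutes with `b_{k'}`). Hence
`‖Σ_k b_k ψ‖² = Σ_{deep} ‖b_k ψ‖² + ‖Σ_{shell} b_k ψ‖² ≤ N/2 + g²` with `g` the multiplicity of the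
Fermi level, and `g ≤ 2L` on the square torus (`card_filter_torusBand_eq_le`: for fixed `k₁`,
`cos(2πk₂/L)` takes each value at most twice).

Sources: J. Bardeen, L. N. Cooper, J. R. Schrieffer, Phys. Rev. 108 (1957) 1175, §II (pair
correlations of the normal Fermi sea are `O(1)` per mode); C. N. Yang, Rev. Mod. Phys. 34 (1962)
694, §3 (no ODLRO for free fermions); E. H. Lieb, M. Loss, Analysis (AMS 2001), Thm 1.14
(bathtub). Folklore finite-dimensional statements; no definitions, no named facts.
-/

noncomputable section

set_option linter.dupNamespace false

namespace Summit.HubbardSuperconductivity.HubbardSuperconductivity.Theorems.NoOnsiteODLRO.FreeEndpoint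

open Matrix Literature.Probability.LatticeModels Literature.MathematicalPhysics.QuantumLattice
open Finset hiding expect
open scoped ComplexOrder ComplexConjugate

/-! ### Every free sector ground state has `S = O(L²)` -/

section Free

variable {L : ℕ} [NeZero L]

/-- **Occupation structure of a free sector ground state.** For `L ≥ 3` and a unit ground state
`ψ` of `H₀ = hubbardTorus 2 L 1 0` in the sector `(2n, S^z = 0)` there are a Fermi set `F` of `n`
momenta and its level `ε_F` such that OFF the shell `{ε_L = ε_F}`: `n_{k↑} ψ = ψ` for `k ∈ F` and
`b_k ψ = 0` for `k ∉ F` (zero bathtub excess forces every off-shell deviation to vanish).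
Lieb–Loss (2001) Thm 1.14; Bardeen–Cooper–Schrieffer (1957) §II. [folklore] -/
theorem exists_fermiSet_of_isGroundStateInSector_free (hL : 3 ≤ L) {n : ℕ}
    {ψ : Fock (Orb (FermionTorus 2 L))}
    (hgs : IsGroundStateInSector (hubbardTorus 2 L 1 0) (2 * n) 0 ψ) (h1 : star ψ ⬝ᵥ ψ = 1) :
    ∃ (F : Finset (TorusSite 2 L)) (eF : ℝ), F.card = n ∧
      (∀ k ∈ F, torusBand L k ≠ eF → momentumNumber k 0 *ᵥ ψ = ψ) ∧
      (∀ k ∉ F, torusBand L k ≠ eF → pairMode k *ᵥ ψ = 0) := by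
  obtain ⟨hmem, _, heig⟩ := hgs
  obtain ⟨F, eF, hFc, hF, hF', hdev⟩ := exists_fermiSet_deviation_le_energy_excess hL hmem h1
  refine ⟨F, eF, hFc, ?_, ?_⟩
  all_goals
    have hE : (star ψ ⬝ᵥ (hubbardTorus 2 L 1 0 *ᵥ ψ)).re =
        (hubbardTorus 2 L 1 0).minEnergyOn (szSector (Λ := FermionTorus 2 L) (2 * n) 0) := by
      rw [heig, dotProduct_smul, h1, smul_eq_mul, mul_one, Complex.ofReal_re]
    rw [hE, sub_self] at hdev
    have hx1 : ∀ k : TorusSite 2 L, (star ψ ⬝ᵥ (momentumNumber k 0 *ᵥ ψ)).re ≤ 1 := fun k => by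
      have := (re_expect_momentumNumber_mem_Icc k 0 ψ).2
      rwa [h1, Complex.one_re] at this
    have hx0 : ∀ k : TorusSite 2 L, 0 ≤ (star ψ ⬝ᵥ (momentumNumber k 0 *ᵥ ψ)).re := fun k =>
      (re_expect_momentumNumber_mem_Icc k 0 ψ).1
    have hterm : ∀ k ∈ (univ : Finset (TorusSite 2 L)), 0 ≤ |torusBand L k - eF| *
        (if k ∈ F then 1 - (star ψ ⬝ᵥ (momentumNumber k 0 *ᵥ ψ)).re
          else (star ψ ⬝ᵥ (momentumNumber k 0 *ᵥ ψ)).re) := by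
      intro k _
      refine mul_nonneg (abs_nonneg _) ?_
      split_ifs
      · linarith [hx1 k]
      · exact hx0 k
    have hzero := (Finset.sum_eq_zero_iff_of_nonneg hterm).1
      (le_antisymm hdev (Finset.sum_nonneg hterm))
  · intro k hkF hk
    have h := hzero k (mem_univ k)
    rw [if_pos hkF, mul_eq_zero] at h
    rcases h with h | h
    · exact absurd (abs_eq_zero.1 h) (sub_ne_zero.2 hk)
    · apply momentumNumber_mulVec_eq_self_of_occupation_eq
      rw [h1, Complex.one_re]
      linarith
  · intro k hkF hk
    have h := hzero k (mem_univ k)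
    rw [if_neg hkF, mul_eq_zero] at h
    rcases h with h | h
    · exact absurd (abs_eq_zero.1 h) (sub_ne_zero.2 hk)
    · exact pairMode_mulVec_eq_zero_of_occupation_eq_zero k h

/-- **Every free sector ground state has `‖Σ_k b_k ψ‖² ≤ n + 4L²`.** For `L ≥ 3` and a unit
ground state `ψ` of the free torus in the sector `(2n, S^z = 0)` (ANY such ground state — the
degenerate open shell included): `Re⟨Bψ, Bψ⟩ ≤ n + (2L)²`, `B = Σ_k b_k` — the deep pair removals
are pairwise orthogonal unit-bounded vectors (`≤ n` of them), the shell carries at most `2L` modes.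
Yang (1962) §3; Bardeen–Cooper–Schrieffer (1957) §II. [folklore] -/
theorem re_star_sum_pairMode_mulVec_self_le_free (hL : 3 ≤ L) {n : ℕ}
    {ψ : Fock (Orb (FermionTorus 2 L))}
    (hgs : IsGroundStateInSector (hubbardTorus 2 L 1 0) (2 * n) 0 ψ) (h1 : star ψ ⬝ᵥ ψ = 1) :
    (star ((∑ k : TorusSite 2 L, pairMode k) *ᵥ ψ) ⬝ᵥ ((∑ k : TorusSite 2 L, pairMode k) *ᵥ ψ)).re ≤
      n + 4 * (L : ℝ) ^ 2 := by
  obtain ⟨F, eF, hFc, hdeep, habove⟩ := exists_fermiSet_of_isGroundStateInSector_free hL hgs h1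
  -- the shell, the deep set, and the decomposition `B ψ = w + u`
  set Sh : Finset (TorusSite 2 L) := univ.filter fun k => torusBand L k = eF with hSh
  set D : Finset (TorusSite 2 L) := univ.filter fun k => torusBand L k ≠ eF ∧ k ∈ F with hD
  set v : TorusSite 2 L → Fock (Orb (FermionTorus 2 L)) := fun k => pairMode k *ᵥ ψ with hv
  have hBψ : (∑ k : TorusSite 2 L, pairMode k) *ᵥ ψ = ∑ k ∈ Sh, v k + ∑ k ∈ D, v k := by
    rw [Matrix.sum_mulVec]
    change ∑ k : TorusSite 2 L, v k = _
    rw [← Finset.sum_filter_add_sum_filter_not univ (fun k => torusBand L k = eF)]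
    congr 1
    rw [hD]
    have : (univ.filter fun k : TorusSite 2 L => torusBand L k ≠ eF ∧ k ∈ F) =
        (univ.filter fun k : TorusSite 2 L => ¬ torusBand L k = eF).filter fun k => k ∈ F := by
      rw [Finset.filter_filter]
    conv_rhs => rw [this, Finset.sum_filter]
    refine Finset.sum_congr rfl fun k hk => ?_
    simp only [mem_filter, mem_univ, true_and] at hk
    split_ifs with hkF
    · rfl
    · exact habove k hkF hk
  -- orthogonality relations
  have hdeep' : ∀ k ∈ D, momentumNumber k 0 *ᵥ ψ = ψ := fun k hk => by
    simp only [hD, mem_filter, mem_univ, true_and] at hk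
    exact hdeep k hk.2 hk.1
  have hcross : star (∑ k ∈ D, v k) ⬝ᵥ (∑ k' ∈ Sh, v k') = 0 := by
    rw [star_sum, sum_dotProduct]
    refine Finset.sum_eq_zero fun k hk => ?_
    rw [dotProduct_sum]
    refine Finset.sum_eq_zero fun k' hk' => ?_
    have hne : k ≠ k' := by
      rintro rfl
      simp only [hD, hSh, mem_filter, mem_univ, true_and] at hk hk'
      exact hk.1 hk'
    exact star_pairMode_mulVec_dotProduct_of_ne hne (hdeep' k hk)
  have hcross' : star (∑ k' ∈ Sh, v k') ⬝ᵥ (∑ k ∈ D, v k) = 0 := by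
    rw [star_dotProduct, hcross, star_zero]
  have hdiag : star (∑ k ∈ D, v k) ⬝ᵥ (∑ k' ∈ D, v k') = ∑ k ∈ D, star (v k) ⬝ᵥ v k := by
    rw [star_sum, sum_dotProduct]
    refine Finset.sum_congr rfl fun k hk => ?_
    rw [dotProduct_sum, Finset.sum_eq_single_of_mem k hk]
    intro k' _ hk'k
    exact star_pairMode_mulVec_dotProduct_of_ne (Ne.symm hk'k) (hdeep' k hk)
  -- the bounds
  have hu : (star (∑ k ∈ D, v k) ⬝ᵥ (∑ k' ∈ D, v k')).re ≤ n := by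
    rw [hdiag, Complex.re_sum]
    calc ∑ k ∈ D, (star (v k) ⬝ᵥ v k).re ≤ ∑ _k ∈ D, (1 : ℝ) :=
          Finset.sum_le_sum fun k _ => by
            have := re_star_pairMode_mulVec_dotProduct_self_le k ψ
            rwa [h1, Complex.one_re] at this
      _ = D.card := by simp
      _ ≤ F.card := by
          exact_mod_cast Finset.card_le_card fun k hk => by
            simp only [hD, mem_filter, mem_univ, true_and] at hk
            exact hk.2
      _ = n := by rw [hFc]
  have hw : (star (∑ k ∈ Sh, v k) ⬝ᵥ (∑ k' ∈ Sh, v k')).re ≤ 4 * (L : ℝ) ^ 2 := by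
    calc (star (∑ k ∈ Sh, v k) ⬝ᵥ (∑ k' ∈ Sh, v k')).re ≤ (Sh.card : ℝ) ^ 2 :=
          re_star_sum_dotProduct_sum_le_card_sq Sh v fun k _ => by
            have := re_star_pairMode_mulVec_dotProduct_self_le k ψ
            rwa [h1, Complex.one_re] at this
      _ ≤ ((2 * L : ℕ) : ℝ) ^ 2 := by
          gcongr
          exact_mod_cast card_filter_torusBand_eq_le (L := L) eF
      _ = 4 * (L : ℝ) ^ 2 := by push_cast; ring
  rw [hBψ, star_add, add_dotProduct, dotProduct_add, dotProduct_add, hcross, hcross',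
    Complex.add_re, Complex.add_re, Complex.add_re, Complex.zero_re]
  linarith

/-- **The free Fermi gas has no on-site pair LRO in ANY sector ground state** (finite-`L`,
quantitative form): for `L ≥ 3`, every particle number `N`, and every unit ground state `ψ` of
`hubbardTorus 2 L 1 0` in the sector `(N, S^z = 0)`,
`Re⟨ψ, P_sᴴ P_s ψ⟩ ≤ N + 8L²` with `P_s = pairField sWave L` — an `L²`, not `L⁴`, law, uniform over
the (possibly exponentially degenerate) ground space. Yang (1962) §3; BCS (1957) §II. [folklore] -/
theorem re_expect_pairField_sWave_le_free (hL : 3 ≤ L) {N : ℕ}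
    {ψ : Fock (Orb (FermionTorus 2 L))}
    (hgs : IsGroundStateInSector (hubbardTorus 2 L 1 0) N 0 ψ) (h1 : star ψ ⬝ᵥ ψ = 1) :
    (expect ((pairField sWave L)ᴴ * pairField sWave L) ψ).re ≤ N + 8 * (L : ℝ) ^ 2 := by
  obtain ⟨n, rfl⟩ := exists_eq_two_mul_of_mem_szSector_zero hgs.1 hgs.2.1
  have h := re_star_sum_pairMode_mulVec_self_le_free hL hgs h1
  rw [expect, conjTranspose_pairField_sWave_mul_self, Matrix.smul_mulVec, dotProduct_smul,
    smul_eq_mul, ← star_mulVec_dotProduct_mulVec, Complex.re_ofReal_mul]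
  push_cast
  linarith

/-- REGISTERED STUB `stub_freeOnsitePairCeiling` of crux stmt-HubbardSuperconductivity-0933 (verbatim
signature; a BY-PRODUCT — the `U = 0` endpoint — not a piece of the composition `NoOnsiteODLRO_of`):
for `L ≥ 3`, every unit `(N, S^z = 0)`-sector ground state `ψ` of the free torus has
`Re⟨ψ, P_sᴴ P_s ψ⟩ ≤ N + 8L²` (`= re_expect_pairField_sWave_le_free`). Yang (1962) §3. [folklore] -/
theorem stub_freeOnsitePairCeiling :
    ∀ (L : ℕ) [NeZero L], 3 ≤ L → ∀ (N : ℕ) (ψ : Fock (Orb (FermionTorus 2 L))),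
      star ψ ⬝ᵥ ψ = 1 → IsGroundStateInSector (hubbardTorus 2 L 1 0) N 0 ψ →
        (expect ((pairField sWave L)ᴴ * pairField sWave L) ψ).re ≤ N + 8 * (L : ℝ) ^ 2 :=
  fun _ _ hL _ _ h1 hgs => re_expect_pairField_sWave_le_free hL hgs h1

/-- **The crux `NoOnsiteODLRO` holds verbatim at the endpoint `U = 0`** (so its hypothesis
`0 < U` is load-bearing only against `U < 0`): for every `δ`, every `N : ℕ → ℕ` and every sequence
`ψ_L` of normalised `(N_L, S^z = 0)`-sector ground states of the FREE torus `hubbardTorus 2 L 1 0`,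
`Re⟨ψ_L, P_sᴴ P_s ψ_L⟩ / L⁴ ≤ ε` eventually in `L` (indeed `≤ 10/L²` for `L ≥ 3`, from
`N_L + 8L² ≤ 10L²`, `N_L ≤ 2L²` being the size of a nonempty sector). The filling constraint and
the evenness clause of the crux's hypothesis block are not used. Yang (1962) §3. [folklore] -/
theorem noOnsiteODLRO_freeEndpoint (δ : ℝ) (N : ℕ → ℕ) (ψ : ∀ L, Fock (Orb (FermionTorus 2 L)))
    (hyp : ∀ L, Even L → N L = 2 * ⌊(1 - δ) * (L : ℝ) ^ 2 / 2⌋₊ ∧ star (ψ L) ⬝ᵥ ψ L = 1 ∧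
      IsGroundStateInSector (hubbardTorus 2 L 1 0) (N L) 0 (ψ L)) :
    ∀ ε : ℝ, 0 < ε → ∃ L₀ : ℕ, ∀ (L : ℕ) [NeZero L], Even L → L₀ ≤ L →
      (expect ((pairField sWave L)ᴴ * pairField sWave L) (ψ L)).re / (L : ℝ) ^ 4 ≤ ε := by
  intro ε hε
  refine ⟨⌈10 / ε⌉₊ + 3, fun L _ hLe hL₀ => ?_⟩
  obtain ⟨_, h1, hgs⟩ := hyp L hLe
  have hL3 : 3 ≤ L := le_of_add_le_right hL₀
  have hLpos : (0 : ℝ) < L := by exact_mod_cast (show 0 < L by omega)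
  -- `N L = 2n ≤ 2 L²` from the sector being nonempty
  obtain ⟨n, hn⟩ := exists_eq_two_mul_of_mem_szSector_zero hgs.1 hgs.2.1
  have hNle : (N L : ℝ) ≤ 2 * (L : ℝ) ^ 2 := by
    obtain ⟨hmem, hne, _⟩ := hgs
    obtain ⟨s, hs⟩ := Function.ne_iff.1 hne
    rw [mem_szSector_iff] at hmem
    have hcard : s.card = N L := by
      by_contra h
      exact hs (hmem.1 s h)
    have : N L ≤ 2 * L ^ 2 := by
      rw [← hcard]
      calc s.card ≤ (univ : Finset (Orb (FermionTorus 2 L))).card := card_le_univ _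
        _ = 2 * L ^ 2 := by
            rw [Finset.card_univ, Fintype.card_congr (toLex : FermionTorus 2 L × Fin 2 ≃ _).symm,
              Fintype.card_prod, Fintype.card_fin]
            simp [mul_comm]
    exact_mod_cast this
  have hS := re_expect_pairField_sWave_le_free hL3 hgs h1
  have hS' : (expect ((pairField sWave L)ᴴ * pairField sWave L) (ψ L)).re ≤ 10 * (L : ℝ) ^ 2 := by
    linarith
  have hL4 : (0 : ℝ) < (L : ℝ) ^ 4 := by positivity
  rw [div_le_iff₀ hL4]
  have hεL : 10 ≤ ε * L := by
    have h1' : (⌈10 / ε⌉₊ : ℝ) + 3 ≤ L := by exact_mod_cast hL₀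
    have h2' : 10 / ε ≤ ⌈10 / ε⌉₊ := Nat.le_ceil _
    have : 10 / ε ≤ L := by linarith
    rwa [div_le_iff₀ hε, mul_comm] at this
  calc (expect ((pairField sWave L)ᴴ * pairField sWave L) (ψ L)).re ≤ 10 * (L : ℝ) ^ 2 := hS'
    _ ≤ ε * L * (L : ℝ) ^ 2 := by gcongr
    _ ≤ ε * (L : ℝ) ^ 4 := by
        have : (L : ℝ) * (L : ℝ) ^ 2 ≤ (L : ℝ) ^ 4 := by
          have h1L : (1 : ℝ) ≤ L := by exact_mod_cast (show 1 ≤ L by omega)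
          nlinarith
        nlinarith

end Free

end Summit.HubbardSuperconductivity.HubbardSuperconductivity.Theorems.NoOnsiteODLRO.FreeEndpoint

end
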